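import Literature.NumberTheory.Sieve.FriedlanderIwaniecPrimesJacobiTwistedTools
import Literature.NumberTheory.Sieve.FriedlanderIwaniecPrimesJacobiTwistedForms
import HarnessLib

/-!
# Friedlander–Iwaniec, *The polynomial `X² + Y⁴` captures its primes*, §11: the bound for `W(d₁, d₂)` in the proof of (11.22)

Family `parity`, statement parity.S17 (`setOf_prime_sq_add_pow_four_infinite`). Source: J. Friedlander,
H. Iwaniec, Ann. of Math. (2) 148 (1998), 945–1040 [FriedlanderIwaniecAnnals1998], §11, proof of
Proposition 11.1, p. 990: "`W(d₁, d₂) = ∑_{a mod q} |∑_{r̄s ≡ a (q)} f(s)(r/d₁'d₂')|²`. By Poisson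
summation for the sum over `s` … by grouping terms according to the product `hr` … by the popular
inequality `|x+y|² ≤ 2|x|² + 2|y|²` and the orthogonality of additive characters … `c_0 = f̂(0) ∑_{(r,q)=1}
(r/d₁'d₂')` … `c_k ≪ τ(k) S (1 + |k|S/qR)⁻²` … Hence `W(d₁, d₂) ≪ q⁻¹ S² |∑_{(r,q)=1} (r/d₁'d₂')|² +
(R + S) R (qR)^ε`."

Fifth file of the §§11–14 unit. Main result **`exists_pair_form_bound`**: for `0 < ε ≤ 1/2` there is
`C` with, for `S, R, q ≥ 1`, `U ⊆ (R, 2R]`, `|χ| ≤ 1`,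
`∑_{a mod q} |∑_{r ∈ U} χ(r) F_q(ar)|² ≤ (3/q)|f̂(0)|² |∑_{r∈U} χ(r)|² + C R (R+S)(qRS)^ε`, where
`F_q(c) = ∑_{s ≡ c (q)} f(s)` and `f = jtMajorant S` (the constant `3` for the printed `2`, and
`(qRS)^ε` for `(qR)^ε`, are immaterial). Everything is PROVED; no definitions, no named facts.
Deviations from the printed argument, all in the direction of more detail: the Poisson series is
truncated at `|k| ≤ L ≍ q²R` with the tail estimated by two partial integrations
(`sum_norm_fourier_tail_le`), so that every exchange of summations is finite; the bound
`∑_{k₂ ≡ k₁ (q)} |c_{k₂}| ≪ (R + S)(qR)^ε` is the layered count `exists_layered_weighted_count_le`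
(dyadic layers `|k| ≤ 2^j q/S` with weights `4^{1−j}`, `min_one_sq_div_le_sum_layers`, each counted
by `exists_card_pairs_mul_congr_le`: the products `k r'` are `≪ 4RX/q + 1` integers in a class,
each with `≤ τ ≤ C_ε (RX)^ε` factorisations), and `∑_{0<|k|≤L} |f̂(k/q)| ≤ 6 C_g q`
(`sum_norm_fourier_trunc_le`, from `sum_inv_one_add_sq_div_le`).

## References

* J. Friedlander, H. Iwaniec, Ann. of Math. (2) 148 (1998), 945–1040, §11, (11.21)–(11.22).
  [FriedlanderIwaniecAnnals1998]

## Tree / Mathlib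

Tree: `jtMajorant`, `jtMajorantC`, `norm_fourier_jtMajorantC_le`, `exists_norm_fourier_jtBumpC_le`,
`tsum_jtMajorantC_arithProg`, `tsum_jtMajorantC_arithProg_eq_sum` (`…JacobiTwistedTools`);
`sum_range_e_mul_div_eq`, `card_filter_product_eq_sum`, `sum_inv_sqrt_two_pow_le`
(`…JacobiTwistedForms`, `…JacobiTwistedLemmas`); `card_le_div_add_one_of_dvd_sub`
(`…JacobiTwistedLemmas`); `exists_sigma_zero_le_mul_rpow` (`DivisorBound`); `sum_Ioc_inv_pow_le`,
`summable_fourier_div` (`FriedlanderIwaniecPrimesPoisson`); `LargeSieve.e`, `e_sub`, `norm_e`,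
`e_zero` (`LargeSieveInequality`). Mathlib: `Summable.sum_add_tsum_compl`, `Real.tsum_le_of_sum_le`,
`norm_tsum_le_tsum_norm`, `Summable.of_norm_bounded`, `Nat.find`, `geom_sum_Ico_le_of_lt_one`.
-/

noncomputable section

open Finset Real Complex MeasureTheory
open scoped FourierTransform ContDiff ComplexConjugate NumberTheorySymbols ArithmeticFunction.sigma Nat

namespace Literature.NumberTheory.Sieve.FriedlanderIwaniecPrimes

open LargeSieve (e)


/-! ### Elementary sums with the weight `(1 + (k/H)²)⁻¹` -/

/-- `∑_{K < k ≤ N} k⁻² ≤ K⁻¹` for `K ≥ 1`. [folklore] -/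
theorem sum_Ioc_inv_sq_le {K : ℕ} (hK : 1 ≤ K) (N : ℕ) :
    ∑ k ∈ Ioc K N, ((k : ℝ) ^ 2)⁻¹ ≤ (K : ℝ)⁻¹ := by
  have := sum_Ioc_inv_pow_le (n := 2) le_rfl hK N
  simpa using this

/-- **`∑_{1 ≤ k ≤ L} (1 + (k/H)²)⁻¹ ≤ 3H`** for `H > 0` (split at `k ≈ H`). [folklore] -/
theorem sum_inv_one_add_sq_div_le {H : ℝ} (hH : 0 < H) (L : ℕ) :
    ∑ k ∈ Icc 1 L, (1 + ((k : ℝ) / H) ^ 2)⁻¹ ≤ 3 * H := by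
  have hterm : ∀ k ∈ Icc 1 L, (1 + ((k : ℝ) / H) ^ 2)⁻¹ ≤ H ^ 2 * ((k : ℝ) ^ 2)⁻¹ := by
    intro k hk
    rw [mem_Icc] at hk
    have hk0 : (0 : ℝ) < k := by exact_mod_cast hk.1
    have hx : 0 < ((k : ℝ) / H) ^ 2 := by positivity
    calc (1 + ((k : ℝ) / H) ^ 2)⁻¹ ≤ (((k : ℝ) / H) ^ 2)⁻¹ := inv_anti₀ hx (by linarith)
      _ = H ^ 2 * ((k : ℝ) ^ 2)⁻¹ := by rw [div_pow, inv_div, div_eq_mul_inv]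
  rcases le_or_gt H 1 with hH1 | hH1
  · -- `H ≤ 1`: every term is at most `H²/k²`, and `∑ k⁻² ≤ 2`
    calc ∑ k ∈ Icc 1 L, (1 + ((k : ℝ) / H) ^ 2)⁻¹ ≤ ∑ k ∈ Icc 1 L, H ^ 2 * ((k : ℝ) ^ 2)⁻¹ :=
          sum_le_sum hterm
      _ = H ^ 2 * ∑ k ∈ Icc 1 L, ((k : ℝ) ^ 2)⁻¹ := by rw [mul_sum]
      _ ≤ H ^ 2 * 2 := by
          refine mul_le_mul_of_nonneg_left ?_ (by positivity)
          rcases Nat.eq_zero_or_pos L with rfl | hL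
          · simp
          · rw [Icc_eq_cons_Ioc hL, sum_cons]
            have := sum_Ioc_inv_sq_le le_rfl L
            norm_num at this ⊢
            linarith
      _ ≤ 3 * H := by nlinarith
  · -- `H > 1`: split at `K = ⌊H⌋ ≥ 1`
    set K := ⌊H⌋₊ with hK
    have hK1 : 1 ≤ K := Nat.le_floor (by exact_mod_cast hH1.le)
    have hKH : (K : ℝ) ≤ H := Nat.floor_le hH.le
    have hHK : H < K + 1 := Nat.lt_floor_add_one H
    have hsplit : Icc 1 L ⊆ Icc 1 K ∪ Ioc K L := by
      intro k hk; rw [mem_Icc] at hk; rw [mem_union, mem_Icc, mem_Ioc]; omega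
    have hdisj : Disjoint (Icc 1 K) (Ioc K L) := by
      rw [disjoint_left]; intro k hk hk'; rw [mem_Icc] at hk; rw [mem_Ioc] at hk'; omega
    calc ∑ k ∈ Icc 1 L, (1 + ((k : ℝ) / H) ^ 2)⁻¹
        ≤ ∑ k ∈ Icc 1 K ∪ Ioc K L, (1 + ((k : ℝ) / H) ^ 2)⁻¹ :=
          sum_le_sum_of_subset_of_nonneg hsplit fun _ _ _ => by positivity
      _ = ∑ k ∈ Icc 1 K, (1 + ((k : ℝ) / H) ^ 2)⁻¹ + ∑ k ∈ Ioc K L, (1 + ((k : ℝ) / H) ^ 2)⁻¹ :=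
          sum_union hdisj
      _ ≤ ∑ k ∈ Icc 1 K, (1 : ℝ) + ∑ k ∈ Ioc K L, H ^ 2 * ((k : ℝ) ^ 2)⁻¹ := by
          gcongr with k hk k hk
          · rw [inv_le_one_iff₀]; right; nlinarith [sq_nonneg ((k : ℝ) / H)]
          · exact hterm k (by rw [mem_Ioc] at hk; rw [mem_Icc]; omega)
      _ = K + H ^ 2 * ∑ k ∈ Ioc K L, ((k : ℝ) ^ 2)⁻¹ := by
          rw [sum_const, Nat.card_Icc, Nat.add_sub_cancel, nsmul_eq_mul, mul_one, mul_sum]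
      _ ≤ K + H ^ 2 * (K : ℝ)⁻¹ := by
          gcongr; exact sum_Ioc_inv_sq_le hK1 L
      _ ≤ 3 * H := by
          have hK0 : (0 : ℝ) < K := by exact_mod_cast hK1
          have hK1' : (1 : ℝ) ≤ K := by exact_mod_cast hK1
          have hH2K : H ≤ 2 * K := by linarith
          have h2 : H ^ 2 * (K : ℝ)⁻¹ ≤ 2 * H := by
            rw [← div_eq_mul_inv, div_le_iff₀ hK0]; nlinarith
          linarith

/-! ### The dyadic layers of the weight `min(1, (H/k)²)` -/

/-- **Layer decomposition.** For `1 ≤ k ≤ 2^J H`: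
`min(1, (H/k)²) ≤ ∑_{j ≤ J} 4^{1-j} [k ≤ 2^j H]`. [folklore] -/
theorem min_one_sq_div_le_sum_layers {H : ℝ} (hH : 0 < H) {J : ℕ} {k : ℝ} (hk0 : 0 < k)
    (hk : k ≤ 2 ^ J * H) :
    min 1 ((H / k) ^ 2) ≤ ∑ j ∈ range (J + 1), if k ≤ 2 ^ j * H then (4 : ℝ) / 4 ^ j else 0 := by
  have hnonneg : ∀ j ∈ range (J + 1), 0 ≤ if k ≤ 2 ^ j * H then (4 : ℝ) / 4 ^ j else 0 :=
    fun j _ => by split_ifs <;> positivity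
  -- the least `i ≤ J` with `k ≤ 2^i H`
  classical
  have hex : ∃ i, k ≤ 2 ^ i * H := ⟨J, hk⟩
  set i := Nat.find hex with hi
  have hik : k ≤ 2 ^ i * H := Nat.find_spec hex
  have hiJ : i ≤ J := Nat.find_min' hex hk
  have hmem : i ∈ range (J + 1) := mem_range.mpr (Nat.lt_succ_of_le hiJ)
  refine le_trans ?_ (single_le_sum hnonneg hmem)
  rw [if_pos hik]
  rcases Nat.eq_zero_or_pos i with h0 | hipos
  · rw [h0, pow_zero, div_one]
    exact (min_le_left _ _).trans (by norm_num)
  · -- `k > 2^{i-1} H`, so `(H/k)² < 4^{1-i}`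
    have hprev : ¬(k ≤ 2 ^ (i - 1) * H) := Nat.find_min hex (by omega)
    push Not at hprev
    refine (min_le_right _ _).trans ?_
    rw [div_pow, div_le_div_iff₀ (by positivity) (by positivity)]
    have h2 : (2 : ℝ) ^ i = 2 * 2 ^ (i - 1) := by
      rw [← pow_succ']; congr 1; omega
    have h4 : (4 : ℝ) ^ i = (2 ^ i) ^ 2 := by
      rw [← pow_mul, mul_comm, pow_mul]; norm_num
    rw [h4, h2]
    nlinarith [mul_pos (pow_pos (two_pos : (0:ℝ) < 2) (i - 1)) hH, sq_nonneg k,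
      sq_nonneg (2 ^ (i - 1) * H), mul_pos hk0 hH]


/-! ### Integers in a residue class in an interval -/

/-- Integers in `[lo, hi]` lying in one residue class modulo `q` number at most
`(hi - lo)/q + 1` (reduction to `card_le_div_add_one_of_dvd_sub`). [folklore] -/
theorem card_le_of_forall_dvd_sub_int {F : Finset ℤ} {lo hi : ℤ} {q : ℕ}
    (hF : ∀ a ∈ F, lo ≤ a ∧ a ≤ hi) (hmod : ∀ a ∈ F, ∀ b ∈ F, (q : ℤ) ∣ a - b) :
    #F ≤ (hi - lo).toNat / q + 1 := by
  have hinj : Set.InjOn (fun a : ℤ => (a - lo).toNat) ↑F := by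
    intro a ha b hb h
    have ha' := (hF a (mem_coe.mp ha)).1
    have hb' := (hF b (mem_coe.mp hb)).1
    have : ((a - lo).toNat : ℤ) = ((b - lo).toNat : ℤ) := by exact_mod_cast h
    rw [Int.toNat_of_nonneg (by linarith), Int.toNat_of_nonneg (by linarith)] at this
    linarith
  rw [← card_image_of_injOn hinj]
  refine card_le_div_add_one_of_dvd_sub (fun s hs => ?_) (fun s hs s' hs' => ?_)
  · rw [mem_image] at hs
    obtain ⟨a, ha, rfl⟩ := hs
    have := hF a ha
    exact Int.toNat_le_toNat (by linarith)
  · rw [mem_image] at hs hs'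
    obtain ⟨a, ha, rfl⟩ := hs
    obtain ⟨b, hb, rfl⟩ := hs'
    have ha' := (hF a ha).1
    have hb' := (hF b hb).1
    rw [Int.toNat_of_nonneg (by linarith), Int.toNat_of_nonneg (by linarith),
      show a - lo - (b - lo) = a - b by ring]
    exact hmod a ha b hb

/-! ### Pairs `(k', r')` with `k' r'` in a fixed class modulo `q` -/

/-- **The count behind "`c_k ≪ τ(k) S (1 + |k|S/qR)⁻²`" summed over a class.** For `ε > 0` there is
`C` with: for `q ≥ 1`, `R, X ≥ 1`, `U ⊆ (R, 2R]` and any integer `m`,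
`#{(k', r') : 0 < |k'| ≤ X, r' ∈ U, k' r' ≡ m (mod q)} ≤ C (RX/q + 1) (RX)^ε` — the products
`k₂ = k'r'` are nonzero integers `≡ m (mod q)` in `[-2RX, 2RX]`, at most `4RX/q + 1` in number,
each with at most `τ(|k₂|) ≤ C_ε |k₂|^ε` factorisations.
[cite: FriedlanderIwaniecAnnals1998, §11, proof of (11.22)] -/
theorem exists_card_pairs_mul_congr_le {ε : ℝ} (hε : 0 < ε) :
    ∃ C : ℝ, 0 < C ∧ ∀ (q R X : ℕ) (m : ℤ) (U : Finset ℕ), 0 < q → 1 ≤ R → 1 ≤ X →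
      U ⊆ Ioc R (2 * R) →
      (#((((Icc (-(X : ℤ)) X).filter (· ≠ 0)) ×ˢ U).filter
          (fun p : ℤ × ℕ => (q : ℤ) ∣ m - p.1 * p.2)) : ℝ) ≤
        C * ((R : ℝ) * X / q + 1) * ((R : ℝ) * X) ^ ε := by
  obtain ⟨Cd, hCd1, hCd⟩ := exists_sigma_zero_le_mul_rpow hε
  refine ⟨4 * Cd * (2 : ℝ) ^ ε, by positivity, fun q R X m U hq hR hX hU => ?_⟩
  set P := (((Icc (-(X : ℤ)) X).filter (· ≠ 0)) ×ˢ U).filter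
    (fun p : ℤ × ℕ => (q : ℤ) ∣ m - p.1 * p.2) with hP
  -- the products
  set T := ((Icc (-(2 * R * X : ℤ)) (2 * R * X)).filter
    (fun k₂ : ℤ => k₂ ≠ 0 ∧ (q : ℤ) ∣ m - k₂)) with hT
  have hmemP : ∀ p ∈ P, p.1 ≠ 0 ∧ -(X : ℤ) ≤ p.1 ∧ p.1 ≤ X ∧ p.2 ∈ U ∧ (q : ℤ) ∣ m - p.1 * p.2 ∧
      1 ≤ p.2 ∧ p.2 ≤ 2 * R := by
    intro p hp
    simp only [hP, mem_filter, mem_product, mem_Icc] at hp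
    have hu := mem_Ioc.mp (hU hp.1.2)
    exact ⟨hp.1.1.2, hp.1.1.1.1, hp.1.1.1.2, hp.1.2, hp.2, by omega, hu.2⟩
  have hprodT : ∀ p ∈ P, p.1 * p.2 ∈ T := by
    intro p hp
    obtain ⟨h0, h1, h2, -, hdvd, h3, h4⟩ := hmemP p hp
    simp only [hT, mem_filter, mem_Icc]
    have h4' : (p.2 : ℤ) ≤ 2 * R := by exact_mod_cast h4
    have h3' : (1 : ℤ) ≤ p.2 := by exact_mod_cast h3
    refine ⟨⟨by nlinarith, by nlinarith⟩, mul_ne_zero h0 (by omega), hdvd⟩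
  -- injection into `{(k₂, d) : k₂ ∈ T, d ∣ |k₂|}`
  have h1 : #P ≤ #(T.sigma fun k₂ => k₂.natAbs.divisors) := by
    refine card_le_card_of_injOn (fun p => (⟨p.1 * p.2, p.2⟩ : Σ _ : ℤ, ℕ)) ?_ ?_
    · intro p hp
      rw [mem_coe] at hp
      obtain ⟨h0, -, -, -, -, h3, -⟩ := hmemP p hp
      rw [mem_coe, mem_sigma, Nat.mem_divisors]
      refine ⟨hprodT p hp, ?_, Int.natAbs_ne_zero.mpr (mul_ne_zero h0 (by omega))⟩
      rw [Int.natAbs_mul, Int.natAbs_natCast]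
      exact Dvd.intro_left _ rfl
    · intro p hp p' hp' h
      simp only [Sigma.mk.inj_iff, heq_eq_eq] at h
      obtain ⟨hprod, h2⟩ := h
      obtain ⟨-, -, -, -, -, h3, -⟩ := hmemP p' (mem_coe.mp hp')
      have hp2 : (p'.2 : ℤ) ≠ 0 := by exact_mod_cast (show p'.2 ≠ 0 by omega)
      rw [h2] at hprod
      exact Prod.ext (mul_right_cancel₀ hp2 hprod) h2
  -- count `T`
  have hT_card : (#T : ℝ) ≤ 4 * R * X / q + 1 := by
    have h := card_le_of_forall_dvd_sub_int (F := T) (lo := -(2 * R * X : ℤ)) (hi := 2 * R * X) (q := q)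
      (fun a ha => by simp only [hT, mem_filter, mem_Icc] at ha; exact ha.1)
      (fun a ha b hb => by
        simp only [hT, mem_filter] at ha hb
        have := dvd_sub hb.2.2 ha.2.2
        rwa [show m - b - (m - a) = a - b by ring] at this)
    have h2 : (((2 * R * X : ℤ) - -(2 * R * X : ℤ)).toNat / q : ℕ) = (4 * R * X) / q := by
      congr 1
      rw [show (2 * R * X : ℤ) - -(2 * R * X : ℤ) = ((4 * R * X : ℕ) : ℤ) by push_cast; ring,
        Int.toNat_natCast]
    rw [h2] at h
    calc (#T : ℝ) ≤ ((4 * R * X / q + 1 : ℕ) : ℝ) := by exact_mod_cast h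
      _ ≤ 4 * R * X / q + 1 := by
          push_cast
          have : ((4 * R * X / q : ℕ) : ℝ) ≤ (4 * R * X : ℕ) / (q : ℝ) := Nat.cast_div_le
          push_cast at this
          linarith
  -- divisor bound on each fibre
  have hfib : ∀ k₂ ∈ T, (#k₂.natAbs.divisors : ℝ) ≤ Cd * (2 * R * X : ℝ) ^ ε := by
    intro k₂ hk₂
    simp only [hT, mem_filter, mem_Icc] at hk₂
    have h := hCd k₂.natAbs
    rw [ArithmeticFunction.sigma_zero_apply] at h
    refine h.trans (mul_le_mul_of_nonneg_left (Real.rpow_le_rpow (Nat.cast_nonneg _) ?_ hε.le)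
      (by linarith))
    have : (k₂.natAbs : ℤ) ≤ 2 * R * X := by rw [Int.natCast_natAbs]; exact abs_le.mpr hk₂.1
    exact_mod_cast this
  have hRX1 : (1 : ℝ) ≤ (R : ℝ) * X := by
    have : (1 : ℝ) ≤ R := by exact_mod_cast hR
    have : (1 : ℝ) ≤ X := by exact_mod_cast hX
    nlinarith
  calc (#P : ℝ) ≤ #(T.sigma fun k₂ => k₂.natAbs.divisors) := by exact_mod_cast h1
    _ = ∑ k₂ ∈ T, (#k₂.natAbs.divisors : ℝ) := by rw [card_sigma]; push_cast; rfl
    _ ≤ ∑ k₂ ∈ T, Cd * (2 * R * X : ℝ) ^ ε := sum_le_sum hfib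
    _ = #T * (Cd * (2 * R * X : ℝ) ^ ε) := by rw [sum_const, nsmul_eq_mul]
    _ ≤ (4 * R * X / q + 1) * (Cd * (2 * R * X : ℝ) ^ ε) :=
        mul_le_mul_of_nonneg_right hT_card (by positivity)
    _ ≤ (4 * ((R : ℝ) * X / q + 1)) * (Cd * ((2 : ℝ) ^ ε * ((R : ℝ) * X) ^ ε)) := by
        refine mul_le_mul ?_ ?_ (by positivity) (by positivity)
        · have : (4 * R * X : ℝ) / q = 4 * ((R : ℝ) * X / q) := by ring
          linarith
        · refine mul_le_mul_of_nonneg_left (le_of_eq ?_) (by linarith)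
          rw [show (2 * R * X : ℝ) = 2 * ((R : ℝ) * X) by ring, Real.mul_rpow (by norm_num) (by positivity)]
    _ = 4 * Cd * (2 : ℝ) ^ ε * ((R : ℝ) * X / q + 1) * ((R : ℝ) * X) ^ ε := by ring




/-- `∑_{k ∈ A} #{r ∈ U : P k r} = #{(k, r) ∈ A × U : P k r}`. [folklore] -/
theorem sum_card_filter_eq_card_filter_product {α β : Type*} (A : Finset α) (U : Finset β)
    (P : α → β → Prop) [∀ a b, Decidable (P a b)] :
    ∑ k ∈ A, #(U.filter fun r => P k r) = #((A ×ˢ U).filter fun p : α × β => P p.1 p.2) := by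
  rw [card_filter_product_eq_sum]

/-- **The layered count.** For `0 < ε ≤ 1/2` there is `C` with: for `q ≥ 1`, `R, S ≥ 1`,
`U ⊆ (R, 2R]`, any `L`, any integer `m` and weights `0 ≤ w(k) ≤ S min(1, (q/(S|k|))²)` (`k ≠ 0`),
`∑_{0 < |k| ≤ L} w(k) #{r' ∈ U : k r' ≡ m (mod q)} ≤ C (R + S) (qR)^ε`
(dyadic layers `|k| ≤ 2^j q/S` with weights `4^{1-j}`, each counted by
`exists_card_pairs_mul_congr_le`; this is the bound `∑_{k₂ ≡ k₁ (q)} |c_{k₂}| ≪ (R + S)(qR)^ε` of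
the source). [cite: FriedlanderIwaniecAnnals1998, §11, proof of (11.22)] -/
theorem exists_layered_weighted_count_le {ε : ℝ} (hε : 0 < ε) (hε2 : ε ≤ 1 / 2) :
    ∃ C : ℝ, 0 < C ∧ ∀ (q R S L : ℕ) (m : ℤ) (U : Finset ℕ) (w : ℤ → ℝ), 0 < q → 1 ≤ R → 1 ≤ S →
      U ⊆ Ioc R (2 * R) → (∀ k, 0 ≤ w k) →
      (∀ k : ℤ, k ≠ 0 → w k ≤ S * min 1 (((q : ℝ) / S / |(k : ℝ)|) ^ 2)) →
      ∑ k ∈ (Icc (-(L : ℤ)) L).filter (· ≠ 0), w k * #(U.filter fun r' : ℕ => (q : ℤ) ∣ m - k * (r' : ℤ)) ≤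
        C * ((R : ℝ) + S) * ((q : ℝ) * R) ^ ε := by
  obtain ⟨Cc, hCc, hcount⟩ := exists_card_pairs_mul_congr_le hε
  refine ⟨16 * Cc, by positivity, fun q R S L m U w hq hR hS hU hw0 hw => ?_⟩
  have hqr : (0 : ℝ) < q := by exact_mod_cast hq
  have hSr : (0 : ℝ) < S := by exact_mod_cast (show 0 < S by omega)
  have hR1 : (1 : ℝ) ≤ R := by exact_mod_cast hR
  have hS1 : (1 : ℝ) ≤ S := by exact_mod_cast hS
  set H : ℝ := q / S with hH
  have hH0 : 0 < H := by positivity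
  set J : ℕ := Nat.log 2 (L * S) + 1 with hJ
  have hJL : (L : ℝ) ≤ 2 ^ J * H := by
    have h1 : ((L * S : ℕ) : ℝ) < (2 : ℝ) ^ J := by
      exact_mod_cast Nat.lt_pow_succ_log_self one_lt_two (L * S)
    push_cast at h1
    rw [hH, mul_div_assoc']
    rw [le_div_iff₀ hSr]
    have : (1 : ℝ) ≤ q := by exact_mod_cast hq
    nlinarith [pow_pos (two_pos : (0:ℝ) < 2) J]
  set K := (Icc (-(L : ℤ)) L).filter (· ≠ (0 : ℤ)) with hK
  set n : ℤ → ℕ := fun k => #(U.filter fun r' : ℕ => (q : ℤ) ∣ m - k * (r' : ℤ)) with hn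
  -- Step 1: insert the layers
  have hlayer : ∀ k ∈ K, w k * n k ≤
      ∑ j ∈ range (J + 1), S * ((if |(k : ℝ)| ≤ 2 ^ j * H then (4 : ℝ) / 4 ^ j else 0) * n k) := by
    intro k hk
    simp only [hK, mem_filter, mem_Icc] at hk
    have hk0 : (0 : ℝ) < |(k : ℝ)| := by rw [abs_pos]; exact_mod_cast hk.2
    have hkL : |(k : ℝ)| ≤ L := by rw [← Int.cast_abs]; exact_mod_cast abs_le.mpr hk.1
    have h1 := min_one_sq_div_le_sum_layers hH0 (J := J) hk0 (hkL.trans hJL)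
    have h2 := hw k hk.2
    have h3 : w k ≤ S * ∑ j ∈ range (J + 1), (if |(k : ℝ)| ≤ 2 ^ j * H then (4 : ℝ) / 4 ^ j else 0) :=
      h2.trans (mul_le_mul_of_nonneg_left h1 hSr.le)
    calc w k * n k ≤ (S * ∑ j ∈ range (J + 1), (if |(k : ℝ)| ≤ 2 ^ j * H then (4 : ℝ) / 4 ^ j else 0)) * n k :=
          mul_le_mul_of_nonneg_right h3 (Nat.cast_nonneg _)
      _ = _ := by rw [mul_assoc, sum_mul, mul_sum]
  -- Step 2: each layer is counted by `hcount`
  have hinner : ∀ j ∈ range (J + 1),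
      ∑ k ∈ K, (if |(k : ℝ)| ≤ 2 ^ j * H then (4 : ℝ) / 4 ^ j else 0) * n k ≤
        (4 : ℝ) / 4 ^ j * (Cc * ((R : ℝ) * (2 ^ j * H) / q + 1) * ((R : ℝ) * (2 ^ j * H)) ^ ε) := by
    intro j _
    set X : ℕ := ⌊(2 : ℝ) ^ j * H⌋₊ with hX
    have hXle : (X : ℝ) ≤ 2 ^ j * H := Nat.floor_le (by positivity)
    -- the `k` that count lie in `0 < |k| ≤ X`
    have hsub : ∀ k ∈ K, |(k : ℝ)| ≤ 2 ^ j * H → k ∈ (Icc (-(X : ℤ)) X).filter (· ≠ 0) := by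
      intro k hk hkj
      simp only [hK, mem_filter, mem_Icc] at hk ⊢
      refine ⟨abs_le.mp ?_, hk.2⟩
      have : |k| ≤ (X : ℤ) := by
        have h1 : ((|k| : ℤ) : ℝ) ≤ 2 ^ j * H := by push_cast; exact hkj
        have h2 : (|k| : ℤ).toNat ≤ X := Nat.le_floor (by
          have : (((|k| : ℤ).toNat : ℕ) : ℝ) = ((|k| : ℤ) : ℝ) := by
            exact_mod_cast Int.toNat_of_nonneg (abs_nonneg k)
          rw [this]; exact h1)
        calc |k| = ((|k|).toNat : ℤ) := (Int.toNat_of_nonneg (abs_nonneg k)).symm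
          _ ≤ X := by exact_mod_cast h2
      exact this
    calc ∑ k ∈ K, (if |(k : ℝ)| ≤ 2 ^ j * H then (4 : ℝ) / 4 ^ j else 0) * n k
        = (4 : ℝ) / 4 ^ j * ∑ k ∈ K.filter (fun k : ℤ => |(k : ℝ)| ≤ 2 ^ j * H), (n k : ℝ) := by
          conv_rhs => rw [mul_sum, sum_filter]
          refine sum_congr rfl fun k _ => ?_
          split_ifs <;> simp
      _ ≤ (4 : ℝ) / 4 ^ j * ∑ k ∈ (Icc (-(X : ℤ)) X).filter (· ≠ 0), (n k : ℝ) := by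
          refine mul_le_mul_of_nonneg_left (sum_le_sum_of_subset_of_nonneg ?_ fun _ _ _ => by positivity)
            (by positivity)
          intro k hk
          rw [mem_filter] at hk
          exact hsub k hk.1 hk.2
      _ ≤ (4 : ℝ) / 4 ^ j * (Cc * ((R : ℝ) * (2 ^ j * H) / q + 1) * ((R : ℝ) * (2 ^ j * H)) ^ ε) := by
          refine mul_le_mul_of_nonneg_left ?_ (by positivity)
          rcases Nat.eq_zero_or_pos X with hX0 | hXpos
          · -- empty layer
            have : (Icc (-(X : ℤ)) X).filter (· ≠ (0 : ℤ)) = ∅ := by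
              rw [hX0]
              refine filter_eq_empty_iff.mpr fun k hk => ?_
              rw [Nat.cast_zero, neg_zero, mem_Icc] at hk
              simp only [ne_eq, not_not]
              omega
            rw [this, sum_empty]; positivity
          · have h := hcount q R X m U hq hR hXpos hU
            simp only [hn]
            rw [← Nat.cast_sum, sum_card_filter_eq_card_filter_product]
            refine h.trans ?_
            have hRX : (R : ℝ) * X ≤ (R : ℝ) * (2 ^ j * H) := mul_le_mul_of_nonneg_left hXle (by positivity)
            gcongr
  -- Step 3: sum the layers
  have hgeom1 : ∀ j : ℕ, ((2 : ℝ) ^ j) ^ ε ≤ Real.sqrt 2 ^ j := by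
    intro j
    calc ((2 : ℝ) ^ j) ^ ε ≤ ((2 : ℝ) ^ j) ^ (1 / 2 : ℝ) :=
          Real.rpow_le_rpow_of_exponent_le (one_le_pow₀ (by norm_num)) hε2
      _ = Real.sqrt 2 ^ j := by
          rw [← Real.sqrt_eq_rpow, show ((2:ℝ) ^ j) = (Real.sqrt 2 ^ j) ^ 2 by
            rw [← pow_mul, mul_comm, pow_mul, Real.sq_sqrt (by norm_num)], Real.sqrt_sq (by positivity)]
  have hRH : ((R : ℝ) * H) ^ ε ≤ ((q : ℝ) * R) ^ ε := by
    refine Real.rpow_le_rpow (by positivity) ?_ hε.le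
    rw [hH, mul_div_assoc', div_le_iff₀ hSr]
    nlinarith [mul_pos hqr (show (0:ℝ) < R by linarith)]
  have hterm : ∀ j ∈ range (J + 1),
      S * ((4 : ℝ) / 4 ^ j * (Cc * ((R : ℝ) * (2 ^ j * H) / q + 1) * ((R : ℝ) * (2 ^ j * H)) ^ ε)) ≤
        4 * Cc * ((q : ℝ) * R) ^ ε * (R * (Real.sqrt 2)⁻¹ ^ j + S * (1 / 2 : ℝ) ^ j) := by
    intro j _
    have h2j : (0 : ℝ) < 2 ^ j := by positivity
    have e1 : (R : ℝ) * (2 ^ j * H) / q = 2 ^ j * R / S := by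
      rw [hH]; field_simp
    have e2 : ((R : ℝ) * (2 ^ j * H)) ^ ε = ((2 : ℝ) ^ j) ^ ε * ((R : ℝ) * H) ^ ε := by
      rw [show (R : ℝ) * (2 ^ j * H) = 2 ^ j * ((R : ℝ) * H) by ring,
        Real.mul_rpow h2j.le (by positivity)]
    rw [e1, e2]
    have h4 : (4 : ℝ) ^ j = 2 ^ j * 2 ^ j := by rw [← mul_pow]; norm_num
    have hs2 : Real.sqrt 2 ^ j * Real.sqrt 2 ^ j = 2 ^ j := by
      rw [← mul_pow, Real.mul_self_sqrt (by norm_num)]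
    have hsq0 : 0 < Real.sqrt 2 ^ j := by positivity
    -- reduce to an inequality between explicit products
    have key1 : S * ((4 : ℝ) / 4 ^ j * (Cc * (2 ^ j * R / S) * (((2 : ℝ) ^ j) ^ ε * ((R : ℝ) * H) ^ ε))) ≤
        4 * Cc * ((q : ℝ) * R) ^ ε * (R * (Real.sqrt 2)⁻¹ ^ j) := by
      have : S * ((4 : ℝ) / 4 ^ j * (Cc * (2 ^ j * R / S) * (((2 : ℝ) ^ j) ^ ε * ((R : ℝ) * H) ^ ε))) =
          4 * Cc * R * (((2 : ℝ) ^ j) ^ ε / 2 ^ j) * ((R : ℝ) * H) ^ ε := by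
        rw [h4]; field_simp
      rw [this]
      have hb : ((2 : ℝ) ^ j) ^ ε / 2 ^ j ≤ (Real.sqrt 2)⁻¹ ^ j := by
        rw [div_le_iff₀ h2j]
        calc ((2 : ℝ) ^ j) ^ ε ≤ Real.sqrt 2 ^ j := hgeom1 j
          _ = (Real.sqrt 2)⁻¹ ^ j * 2 ^ j := by
              rw [inv_pow, ← hs2, ← mul_assoc, inv_mul_cancel₀ hsq0.ne', one_mul]
      calc 4 * Cc * R * (((2 : ℝ) ^ j) ^ ε / 2 ^ j) * ((R : ℝ) * H) ^ ε
          ≤ 4 * Cc * R * (Real.sqrt 2)⁻¹ ^ j * ((q : ℝ) * R) ^ ε := by gcongr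
        _ = 4 * Cc * ((q : ℝ) * R) ^ ε * (R * (Real.sqrt 2)⁻¹ ^ j) := by ring
    have key2 : S * ((4 : ℝ) / 4 ^ j * (Cc * 1 * (((2 : ℝ) ^ j) ^ ε * ((R : ℝ) * H) ^ ε))) ≤
        4 * Cc * ((q : ℝ) * R) ^ ε * (S * (1 / 2 : ℝ) ^ j) := by
      have : S * ((4 : ℝ) / 4 ^ j * (Cc * 1 * (((2 : ℝ) ^ j) ^ ε * ((R : ℝ) * H) ^ ε))) =
          4 * Cc * S * (((2 : ℝ) ^ j) ^ ε / 4 ^ j) * ((R : ℝ) * H) ^ ε := by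
        field_simp
      rw [this]
      have hb : ((2 : ℝ) ^ j) ^ ε / 4 ^ j ≤ (1 / 2 : ℝ) ^ j := by
        rw [div_le_iff₀ (by positivity), h4, one_div, inv_pow, ← mul_assoc, inv_mul_cancel₀ h2j.ne', one_mul]
        calc ((2 : ℝ) ^ j) ^ ε ≤ Real.sqrt 2 ^ j := hgeom1 j
          _ ≤ 2 ^ j := pow_le_pow_left₀ (Real.sqrt_nonneg 2) (by
              rw [Real.sqrt_le_left (by norm_num)]; norm_num) j
      calc 4 * Cc * S * (((2 : ℝ) ^ j) ^ ε / 4 ^ j) * ((R : ℝ) * H) ^ ε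
          ≤ 4 * Cc * S * (1 / 2 : ℝ) ^ j * ((q : ℝ) * R) ^ ε := by gcongr
        _ = 4 * Cc * ((q : ℝ) * R) ^ ε * (S * (1 / 2 : ℝ) ^ j) := by ring
    have hsplit : S * ((4 : ℝ) / 4 ^ j * (Cc * (2 ^ j * R / S + 1) * (((2 : ℝ) ^ j) ^ ε * ((R : ℝ) * H) ^ ε))) =
        S * ((4 : ℝ) / 4 ^ j * (Cc * (2 ^ j * R / S) * (((2 : ℝ) ^ j) ^ ε * ((R : ℝ) * H) ^ ε))) +
        S * ((4 : ℝ) / 4 ^ j * (Cc * 1 * (((2 : ℝ) ^ j) ^ ε * ((R : ℝ) * H) ^ ε))) := by ring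
    rw [hsplit, mul_add (4 * Cc * ((q : ℝ) * R) ^ ε)]
    exact add_le_add key1 key2
  -- assemble
  calc ∑ k ∈ K, w k * (n k : ℝ)
      ≤ ∑ k ∈ K, ∑ j ∈ range (J + 1), S * ((if |(k : ℝ)| ≤ 2 ^ j * H then (4 : ℝ) / 4 ^ j else 0) * n k) :=
        sum_le_sum hlayer
    _ = ∑ j ∈ range (J + 1), S * ∑ k ∈ K, (if |(k : ℝ)| ≤ 2 ^ j * H then (4 : ℝ) / 4 ^ j else 0) * n k := by
        rw [sum_comm]; exact sum_congr rfl fun j _ => by rw [mul_sum]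
    _ ≤ ∑ j ∈ range (J + 1), S * ((4 : ℝ) / 4 ^ j *
          (Cc * ((R : ℝ) * (2 ^ j * H) / q + 1) * ((R : ℝ) * (2 ^ j * H)) ^ ε)) :=
        sum_le_sum fun j hj => mul_le_mul_of_nonneg_left (hinner j hj) hSr.le
    _ ≤ ∑ j ∈ range (J + 1), 4 * Cc * ((q : ℝ) * R) ^ ε * (R * (Real.sqrt 2)⁻¹ ^ j + S * (1 / 2 : ℝ) ^ j) :=
        sum_le_sum hterm
    _ = 4 * Cc * ((q : ℝ) * R) ^ ε * (R * ∑ j ∈ range (J + 1), (Real.sqrt 2)⁻¹ ^ j +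
          S * ∑ j ∈ range (J + 1), (1 / 2 : ℝ) ^ j) := by
        rw [← mul_sum, sum_add_distrib, mul_sum, mul_sum]
    _ ≤ 4 * Cc * ((q : ℝ) * R) ^ ε * (R * 4 + S * 2) := by
        gcongr
        · exact sum_inv_sqrt_two_pow_le _
        · have := geom_sum_Ico_le_of_lt_one (m := 0) (n := J + 1) (x := (1 / 2 : ℝ)) (by norm_num) (by norm_num)
          rw [pow_zero, range_eq_Ico] at *
          refine this.trans ?_
          norm_num
    _ ≤ 16 * Cc * ((R : ℝ) + S) * ((q : ℝ) * R) ^ ε := by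
        have : 0 ≤ Cc * ((q : ℝ) * R) ^ ε := by positivity
        nlinarith





/-! ### Helpers for the per-pair bound -/

/-- `‖x + y + z‖² ≤ 3 (‖x‖² + ‖y‖² + ‖z‖²)`. [folklore] -/
theorem norm_add_three_sq_le (x y z : ℂ) :
    ‖x + y + z‖ ^ 2 ≤ 3 * (‖x‖ ^ 2 + ‖y‖ ^ 2 + ‖z‖ ^ 2) := by
  have h := norm_add₃_le (a := x) (b := y) (c := z)
  have h0 : 0 ≤ ‖x‖ + ‖y‖ + ‖z‖ := by positivity
  calc ‖x + y + z‖ ^ 2 ≤ (‖x‖ + ‖y‖ + ‖z‖) ^ 2 := pow_le_pow_left₀ (norm_nonneg _) h 2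
    _ ≤ 3 * (‖x‖ ^ 2 + ‖y‖ ^ 2 + ‖z‖ ^ 2) := by
        nlinarith [sq_nonneg (‖x‖ - ‖y‖), sq_nonneg (‖y‖ - ‖z‖), sq_nonneg (‖x‖ - ‖z‖)]

/-- **Expanding a sum of squared norms of sums:**
`∑_a ‖∑_k x(a,k)‖² = ∑_k ∑_{k'} ∑_a x(a,k) conj x(a,k')` (as complex numbers). [folklore] -/
theorem sum_norm_sq_sum_eq {α β : Type*} (A : Finset α) (K : Finset β) (x : α → β → ℂ) :
    ((∑ a ∈ A, ‖∑ k ∈ K, x a k‖ ^ 2 : ℝ) : ℂ) =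
      ∑ k ∈ K, ∑ k' ∈ K, ∑ a ∈ A, x a k * conj (x a k') := by
  push_cast
  calc ∑ a ∈ A, ((‖∑ k ∈ K, x a k‖ : ℂ)) ^ 2
      = ∑ a ∈ A, (∑ k ∈ K, x a k) * conj (∑ k' ∈ K, x a k') := by
        refine sum_congr rfl fun a _ => ?_
        rw [← Complex.ofReal_pow, ← Complex.normSq_eq_norm_sq, Complex.normSq_eq_conj_mul_self, mul_comm]
    _ = ∑ a ∈ A, ∑ k ∈ K, ∑ k' ∈ K, x a k * conj (x a k') := by
        refine sum_congr rfl fun a _ => ?_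
        rw [map_sum, sum_mul_sum]
    _ = ∑ k ∈ K, ∑ k' ∈ K, ∑ a ∈ A, x a k * conj (x a k') := by
        rw [sum_comm]
        exact sum_congr rfl fun k _ => sum_comm

/-- `e(s) conj(e(t)) = e(s - t)`. [folklore] -/
theorem e_mul_conj_e (s t : ℝ) : e s * conj (e t) = e (s - t) := (LargeSieve.e_sub s t).symm

/-! ### The Fourier coefficients `ŵ_k = f̂(k/q)` of the majorant -/

/-- The bound `|f̂(k/q)| ≤ C_g S min(1, (q/(S|k|))²)` in the form used by the layered count.
[cite: FriedlanderIwaniecAnnals1998, §11, "`f̂(t) ≪ S(1 + |t|S)⁻²`"] -/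
theorem norm_fourier_jtMajorantC_div_le_min {C : ℝ} (hC : ∀ ξ : ℝ, ‖𝓕 jtBumpC ξ‖ ≤ C / (1 + ξ ^ 2))
    (hC0 : 0 ≤ C) {S : ℝ} (hS : 0 < S) {q : ℝ} (hq : 0 < q) {k : ℝ} (hk : k ≠ 0) :
    ‖𝓕 (jtMajorantC S) (k / q)‖ ≤ C * (S * min 1 ((q / S / |k|) ^ 2)) := by
  have h := norm_fourier_jtMajorantC_le hC hS (k / q)
  refine h.trans ?_
  have hx : 0 < (S * (k / q)) ^ 2 := by positivity
  have hmin : 1 / (1 + (S * (k / q)) ^ 2) ≤ min 1 ((q / S / |k|) ^ 2) := by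
    rw [le_min_iff]
    constructor
    · rw [div_le_one (by positivity)]; linarith
    · calc 1 / (1 + (S * (k / q)) ^ 2) ≤ 1 / (S * (k / q)) ^ 2 :=
            one_div_le_one_div_of_le hx (by linarith)
        _ = (q / S / |k|) ^ 2 := by
            rw [div_pow, div_pow, one_div, sq_abs, mul_pow, div_pow]
            field_simp
  calc C * S / (1 + (S * (k / q)) ^ 2) = C * S * (1 / (1 + (S * (k / q)) ^ 2)) := by ring
    _ ≤ C * S * min 1 ((q / S / |k|) ^ 2) := mul_le_mul_of_nonneg_left hmin (by positivity)
    _ = C * (S * min 1 ((q / S / |k|) ^ 2)) := by ring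

/-- `|f̂(k/q)| ≤ C_g S`. [folklore] -/
theorem norm_fourier_jtMajorantC_div_le_const {C : ℝ} (hC : ∀ ξ : ℝ, ‖𝓕 jtBumpC ξ‖ ≤ C / (1 + ξ ^ 2))
    (hC0 : 0 ≤ C) {S : ℝ} (hS : 0 < S) (ξ : ℝ) : ‖𝓕 (jtMajorantC S) ξ‖ ≤ C * S := by
  refine (norm_fourier_jtMajorantC_le hC hS ξ).trans ?_
  rw [div_le_iff₀ (by positivity)]
  nlinarith [sq_nonneg (S * ξ), mul_nonneg hC0 hS.le]

/-- `|f̂(k/q)| ≤ C_g q²/(S k²)` for `k ≠ 0` (the form used for the tail). [folklore] -/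
theorem norm_fourier_jtMajorantC_div_le_inv_sq {C : ℝ} (hC : ∀ ξ : ℝ, ‖𝓕 jtBumpC ξ‖ ≤ C / (1 + ξ ^ 2))
    (hC0 : 0 ≤ C) {S : ℝ} (hS : 0 < S) {q : ℝ} (hq : 0 < q) {k : ℝ} (hk : k ≠ 0) :
    ‖𝓕 (jtMajorantC S) (k / q)‖ ≤ C * q ^ 2 / S * (k ^ 2)⁻¹ := by
  refine (norm_fourier_jtMajorantC_div_le_min hC hC0 hS hq hk).trans ?_
  have hk2 : 0 < k ^ 2 := by positivity
  calc C * (S * min 1 ((q / S / |k|) ^ 2)) ≤ C * (S * (q / S / |k|) ^ 2) := by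
        gcongr; exact min_le_right _ _
    _ = C * q ^ 2 / S * (k ^ 2)⁻¹ := by
        rw [div_pow, div_pow, sq_abs]; field_simp

/-- **The tail of `∑_k |f̂(k/q)|`:** every finite set of integers `k` with `|k| > L ≥ 1` has
`∑ |f̂(k/q)| ≤ 2 C_g q² /(S L)`. [folklore] -/
theorem sum_norm_fourier_tail_le {C : ℝ} (hC : ∀ ξ : ℝ, ‖𝓕 jtBumpC ξ‖ ≤ C / (1 + ξ ^ 2))
    (hC0 : 0 ≤ C) {S : ℝ} (hS : 0 < S) {q : ℕ} (hq : 0 < q) {L : ℕ} (hL : 1 ≤ L)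
    (F : Finset ℤ) (hF : ∀ k ∈ F, (L : ℤ) < |k|) :
    ∑ k ∈ F, ‖𝓕 (jtMajorantC S) ((k : ℝ) / q)‖ ≤ 2 * (C * (q : ℝ) ^ 2 / S) / L := by
  have hqr : (0 : ℝ) < q := by exact_mod_cast hq
  -- bound by the sum over `L < |k| ≤ N`
  obtain ⟨N, hN⟩ : ∃ N : ℕ, ∀ k ∈ F, |k| ≤ N := by
    rcases F.eq_empty_or_nonempty with h | hne
    · exact ⟨0, by simp [h]⟩
    · refine ⟨(F.image fun k => |k|).max' (hne.image _) |>.toNat, fun k hk => ?_⟩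
      have := le_max' (F.image fun k => |k|) |k| (mem_image_of_mem _ hk)
      exact this.trans (Int.self_le_toNat _)
  set M : ℝ := C * (q : ℝ) ^ 2 / S with hM
  have hM0 : 0 ≤ M := by positivity
  have hbound : ∀ k ∈ F, ‖𝓕 (jtMajorantC S) ((k : ℝ) / q)‖ ≤ M * (((k.natAbs : ℕ) : ℝ) ^ 2)⁻¹ := by
    intro k hk
    have hk0 : (k : ℝ) ≠ 0 := by
      have := hF k hk
      have : k ≠ 0 := fun h => by rw [h, abs_zero] at this; omega
      exact_mod_cast this
    refine (norm_fourier_jtMajorantC_div_le_inv_sq hC hC0 hS hqr hk0).trans (le_of_eq ?_)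
    rw [hM, Nat.cast_natAbs, Int.cast_abs, sq_abs]
  -- split `F` by sign and inject into `Ioc L N`
  have hpos : ∑ k ∈ F.filter (fun k => 0 < k), M * (((k.natAbs : ℕ) : ℝ) ^ 2)⁻¹ ≤ M * (L : ℝ)⁻¹ := by
    calc ∑ k ∈ F.filter (fun k => 0 < k), M * (((k.natAbs : ℕ) : ℝ) ^ 2)⁻¹
        = ∑ n ∈ (F.filter (fun k => 0 < k)).image Int.natAbs, M * (((n : ℕ) : ℝ) ^ 2)⁻¹ := by
          rw [sum_image]
          intro a ha b hb h
          rw [mem_coe, mem_filter] at ha hb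
          have := Int.natAbs_inj_of_nonneg_of_nonneg ha.2.le hb.2.le |>.mp h
          exact this
      _ ≤ ∑ n ∈ Ioc L N, M * (((n : ℕ) : ℝ) ^ 2)⁻¹ := by
          refine sum_le_sum_of_subset_of_nonneg ?_ fun _ _ _ => by positivity
          intro n hn
          rw [mem_image] at hn
          obtain ⟨k, hk, rfl⟩ := hn
          rw [mem_filter] at hk
          have h1 := hF k hk.1
          have h2 := hN k hk.1
          rw [mem_Ioc]
          constructor
          · have : (L : ℤ) < (k.natAbs : ℤ) := by rwa [Int.natCast_natAbs]
            exact_mod_cast this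
          · have : (k.natAbs : ℤ) ≤ N := by rwa [Int.natCast_natAbs]
            exact_mod_cast this
      _ = M * ∑ n ∈ Ioc L N, (((n : ℕ) : ℝ) ^ 2)⁻¹ := by rw [mul_sum]
      _ ≤ M * (L : ℝ)⁻¹ := mul_le_mul_of_nonneg_left (sum_Ioc_inv_sq_le hL N) hM0
  have hneg : ∑ k ∈ F.filter (fun k => ¬0 < k), M * (((k.natAbs : ℕ) : ℝ) ^ 2)⁻¹ ≤ M * (L : ℝ)⁻¹ := by
    calc ∑ k ∈ F.filter (fun k => ¬0 < k), M * (((k.natAbs : ℕ) : ℝ) ^ 2)⁻¹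
        = ∑ n ∈ (F.filter (fun k => ¬0 < k)).image Int.natAbs, M * (((n : ℕ) : ℝ) ^ 2)⁻¹ := by
          rw [sum_image]
          intro a ha b hb h
          rw [mem_coe, mem_filter] at ha hb
          have := Int.natAbs_inj_of_nonpos_of_nonpos (not_lt.mp ha.2) (not_lt.mp hb.2) |>.mp h
          exact this
      _ ≤ ∑ n ∈ Ioc L N, M * (((n : ℕ) : ℝ) ^ 2)⁻¹ := by
          refine sum_le_sum_of_subset_of_nonneg ?_ fun _ _ _ => by positivity
          intro n hn
          rw [mem_image] at hn
          obtain ⟨k, hk, rfl⟩ := hn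
          rw [mem_filter] at hk
          have h1 := hF k hk.1
          have h2 := hN k hk.1
          rw [mem_Ioc]
          constructor
          · have : (L : ℤ) < (k.natAbs : ℤ) := by rwa [Int.natCast_natAbs]
            exact_mod_cast this
          · have : (k.natAbs : ℤ) ≤ N := by rwa [Int.natCast_natAbs]
            exact_mod_cast this
      _ = M * ∑ n ∈ Ioc L N, (((n : ℕ) : ℝ) ^ 2)⁻¹ := by rw [mul_sum]
      _ ≤ M * (L : ℝ)⁻¹ := mul_le_mul_of_nonneg_left (sum_Ioc_inv_sq_le hL N) hM0
  calc ∑ k ∈ F, ‖𝓕 (jtMajorantC S) ((k : ℝ) / q)‖ ≤ ∑ k ∈ F, M * (((k.natAbs : ℕ) : ℝ) ^ 2)⁻¹ :=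
        sum_le_sum hbound
    _ = ∑ k ∈ F.filter (fun k => 0 < k), M * (((k.natAbs : ℕ) : ℝ) ^ 2)⁻¹ +
        ∑ k ∈ F.filter (fun k => ¬0 < k), M * (((k.natAbs : ℕ) : ℝ) ^ 2)⁻¹ :=
        (sum_filter_add_sum_filter_not _ _ _).symm
    _ ≤ M * (L : ℝ)⁻¹ + M * (L : ℝ)⁻¹ := add_le_add hpos hneg
    _ = 2 * M / L := by ring





/-- Summability of `k ↦ |f̂(k/q)|` over `ℤ`. [folklore] -/
theorem summable_norm_fourier_jtMajorantC_div {S : ℝ} (hS : 0 < S) {q : ℝ} (hq : 0 < q) :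
    Summable fun k : ℤ => ‖𝓕 (jtMajorantC S) ((k : ℝ) / q)‖ :=
  (summable_fourier_div (contDiff_jtMajorantC S) (hasCompactSupport_jtMajorantC hS) hq).norm

/-- `∑_{0 < |k| ≤ L} |f̂(k/q)| ≤ 6 C_g q` ("`∑_{k₁} |c_{k₁}| ≪ S K'`"). [folklore] -/
theorem sum_norm_fourier_trunc_le {C : ℝ} (hC : ∀ ξ : ℝ, ‖𝓕 jtBumpC ξ‖ ≤ C / (1 + ξ ^ 2))
    (hC0 : 0 ≤ C) {S : ℝ} (hS : 0 < S) {q : ℕ} (hq : 0 < q) (L : ℕ) :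
    ∑ k ∈ (Icc (-(L : ℤ)) L).filter (· ≠ 0), ‖𝓕 (jtMajorantC S) ((k : ℝ) / q)‖ ≤ 6 * C * q := by
  have hqr : (0 : ℝ) < q := by exact_mod_cast hq
  set H : ℝ := q / S with hH
  have hH0 : 0 < H := by positivity
  have hterm : ∀ k : ℤ, ‖𝓕 (jtMajorantC S) ((k : ℝ) / q)‖ ≤ C * S * (1 + (((k.natAbs : ℕ) : ℝ) / H) ^ 2)⁻¹ := by
    intro k
    refine (norm_fourier_jtMajorantC_le hC hS _).trans (le_of_eq ?_)
    rw [div_eq_mul_inv]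
    congr 2
    rw [hH, Nat.cast_natAbs, Int.cast_abs, div_div_eq_mul_div, ← sq_abs (S * _), abs_mul, abs_of_pos hS,
      abs_div, abs_of_pos hqr]
    ring
  set K := (Icc (-(L : ℤ)) L).filter (· ≠ (0 : ℤ)) with hK
  have hsplit : ∀ P : ℤ → Prop, ∀ [DecidablePred P],
      (∀ a ∈ K.filter P, ∀ b ∈ K.filter P, a.natAbs = b.natAbs → a = b) →
      ∑ k ∈ K.filter P, C * S * (1 + (((k.natAbs : ℕ) : ℝ) / H) ^ 2)⁻¹ ≤ C * S * (3 * H) := by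
    intro P _ hinj
    calc ∑ k ∈ K.filter P, C * S * (1 + (((k.natAbs : ℕ) : ℝ) / H) ^ 2)⁻¹
        = ∑ n ∈ (K.filter P).image Int.natAbs, C * S * (1 + ((n : ℝ) / H) ^ 2)⁻¹ := by
          rw [sum_image fun a ha b hb h => hinj a ha b hb h]
      _ ≤ ∑ n ∈ Icc 1 L, C * S * (1 + ((n : ℝ) / H) ^ 2)⁻¹ := by
          refine sum_le_sum_of_subset_of_nonneg ?_ fun _ _ _ => by positivity
          intro n hn
          rw [mem_image] at hn
          obtain ⟨k, hk, rfl⟩ := hn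
          simp only [hK, mem_filter, mem_Icc] at hk
          rw [mem_Icc]
          constructor
          · exact Int.natAbs_pos.mpr hk.1.2
          · have : (k.natAbs : ℤ) ≤ L := by rw [Int.natCast_natAbs]; exact abs_le.mpr hk.1.1
            exact_mod_cast this
      _ = C * S * ∑ n ∈ Icc 1 L, (1 + ((n : ℝ) / H) ^ 2)⁻¹ := by rw [mul_sum]
      _ ≤ C * S * (3 * H) := mul_le_mul_of_nonneg_left (sum_inv_one_add_sq_div_le hH0 L) (by positivity)
  calc ∑ k ∈ K, ‖𝓕 (jtMajorantC S) ((k : ℝ) / q)‖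
      ≤ ∑ k ∈ K, C * S * (1 + (((k.natAbs : ℕ) : ℝ) / H) ^ 2)⁻¹ := sum_le_sum fun k _ => hterm k
    _ = ∑ k ∈ K.filter (fun k => 0 < k), C * S * (1 + (((k.natAbs : ℕ) : ℝ) / H) ^ 2)⁻¹ +
        ∑ k ∈ K.filter (fun k => ¬0 < k), C * S * (1 + (((k.natAbs : ℕ) : ℝ) / H) ^ 2)⁻¹ :=
        (sum_filter_add_sum_filter_not _ _ _).symm
    _ ≤ C * S * (3 * H) + C * S * (3 * H) := by
        refine add_le_add (hsplit _ fun a ha b hb h => ?_) (hsplit _ fun a ha b hb h => ?_)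
        · rw [mem_filter] at ha hb
          exact (Int.natAbs_inj_of_nonneg_of_nonneg ha.2.le hb.2.le).mp h
        · rw [mem_filter] at ha hb
          exact (Int.natAbs_inj_of_nonpos_of_nonpos (not_lt.mp ha.2) (not_lt.mp hb.2)).mp h
    _ = 6 * C * q := by rw [hH]; field_simp; ring





/-- Orthogonality applied to `G(a,k) conj G(a,k')`:
`‖∑_{a<q} (∑_r χ_r e(ark/q)) conj(∑_{r'} χ_{r'} e(ar'k'/q))‖ ≤ q #{(r,r') : q ∣ rk − r'k'}` for
`|χ| ≤ 1`. [folklore] -/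
theorem norm_sum_G_mul_conj_G_le {q : ℕ} (hq : 0 < q) (U : Finset ℕ) {χ : ℕ → ℂ}
    (hχ : ∀ r, ‖χ r‖ ≤ 1) (k k' : ℤ) :
    ‖∑ a ∈ range q, (∑ r ∈ U, χ r * e ((a * r : ℕ) * (k : ℝ) / q)) *
        conj (∑ r' ∈ U, χ r' * e ((a * r' : ℕ) * (k' : ℝ) / q))‖ ≤
      q * #((U ×ˢ U).filter fun p : ℕ × ℕ => (q : ℤ) ∣ (p.1 : ℤ) * k - k' * p.2) := by
  -- expand and use orthogonality
  have hexp : ∑ a ∈ range q, (∑ r ∈ U, χ r * e ((a * r : ℕ) * (k : ℝ) / q)) *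
      conj (∑ r' ∈ U, χ r' * e ((a * r' : ℕ) * (k' : ℝ) / q)) =
      ∑ p ∈ U ×ˢ U, χ p.1 * conj (χ p.2) *
        ∑ a ∈ range q, e ((a : ℝ) * ((p.1 : ℤ) * k - k' * p.2 : ℤ) / q) := by
    calc _ = ∑ a ∈ range q, ∑ p ∈ U ×ˢ U, χ p.1 * conj (χ p.2) *
          e ((a : ℝ) * ((p.1 : ℤ) * k - k' * p.2 : ℤ) / q) := by
            refine sum_congr rfl fun a _ => ?_
            rw [map_sum, sum_mul_sum, ← sum_product']
            refine sum_congr rfl fun p _ => ?_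
            have : ((a * p.1 : ℕ) : ℝ) * (k : ℝ) / q - ((a * p.2 : ℕ) : ℝ) * (k' : ℝ) / q =
                (a : ℝ) * (((p.1 : ℤ) * k - k' * p.2 : ℤ) : ℝ) / q := by push_cast; ring
            rw [map_mul, ← this, ← e_mul_conj_e]
            ring
      _ = _ := by
            rw [sum_comm]
            exact sum_congr rfl fun p _ => by rw [mul_sum]
  rw [hexp]
  refine (norm_sum_le _ _).trans ?_
  have hterm : ∀ p ∈ U ×ˢ U, ‖χ p.1 * conj (χ p.2) *
      ∑ a ∈ range q, e ((a : ℝ) * ((p.1 : ℤ) * k - k' * p.2 : ℤ) / q)‖ ≤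
        if (q : ℤ) ∣ (p.1 : ℤ) * k - k' * p.2 then (q : ℝ) else 0 := by
    intro p _
    rw [sum_range_e_mul_div_eq hq, norm_mul, norm_mul, Complex.norm_conj]
    split_ifs with h
    · calc ‖χ p.1‖ * ‖χ p.2‖ * ‖(q : ℂ)‖ ≤ 1 * 1 * q := by
            rw [Complex.norm_natCast]
            exact mul_le_mul (mul_le_mul (hχ _) (hχ _) (norm_nonneg _) zero_le_one) le_rfl
              (Nat.cast_nonneg _) (by norm_num)
        _ = q := by ring
    · simp
  refine (sum_le_sum hterm).trans (le_of_eq ?_)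
  rw [← sum_filter, sum_const, nsmul_eq_mul, mul_comm]





/-- **The per-pair bound** (the estimate of `W(d₁, d₂)` in the proof of (11.22)): for
`0 < ε ≤ 1/2` there is `C` such that for `S, R, q ≥ 1`, `U ⊆ (R, 2R]`, `|χ| ≤ 1`,
`∑_{a mod q} |∑_{r ∈ U} χ(r) F_q(ar)|² ≤ (3/q) |f̂(0)|² |∑_{r ∈ U} χ(r)|² + C R (R + S) (qRS)^ε`,
where `F_q(c) = ∑_{s ≡ c (q)} f(s)` with `f` the smooth majorant of `(S, 2S]` ("`W(d₁, d₂) ≪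
q⁻¹ S² |∑_{(r,q)=1} (r/d₁'d₂')|² + (R + S) R (qR)^ε`": Poisson summation in `s`, the zero frequency
gives the first term, the others are bounded through orthogonality in `a` and the layered count
`exists_layered_weighted_count_le`; the Poisson series is truncated at `|k| ≤ L ≍ q²R` with a
negligible tail). [cite: FriedlanderIwaniecAnnals1998, §11, proof of (11.22)] -/
theorem exists_pair_form_bound {ε : ℝ} (hε : 0 < ε) (hε2 : ε ≤ 1 / 2) :
    ∃ C : ℝ, 0 < C ∧ ∀ (S R q : ℕ) (U : Finset ℕ) (χ : ℕ → ℂ), 1 ≤ S → 1 ≤ R → 1 ≤ q →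
      U ⊆ Ioc R (2 * R) → (∀ r, ‖χ r‖ ≤ 1) →
      ∑ a ∈ range q, ‖∑ r ∈ U, χ r *
          ∑ s ∈ (range (3 * S)).filter (fun s : ℕ => (q : ℤ) ∣ (s : ℤ) - ((a * r : ℕ) : ℤ)),
            (jtMajorant S s : ℂ)‖ ^ 2 ≤
        3 / q * ‖𝓕 (jtMajorantC S) 0‖ ^ 2 * ‖∑ r ∈ U, χ r‖ ^ 2 +
          C * R * ((R : ℝ) + S) * ((q : ℝ) * R * S) ^ ε := by
  obtain ⟨Cg, hCg0, hCg⟩ := exists_norm_fourier_jtBumpC_le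
  obtain ⟨Cl, hCl0, hCl⟩ := exists_layered_weighted_count_le hε hε2
  refine ⟨18 * Cg ^ 2 * Cl + 3, by positivity, fun S R q U χ hS hR hq hU hχ => ?_⟩
  -- basic quantities
  have hSr : (0 : ℝ) < S := by exact_mod_cast (show 0 < S by omega)
  have hqr : (0 : ℝ) < q := by exact_mod_cast (show 0 < q by omega)
  have hq0 : 0 < q := by omega
  have hR1 : (1 : ℝ) ≤ R := by exact_mod_cast hR
  have hS1 : (1 : ℝ) ≤ S := by exact_mod_cast hS
  have hq1 : (1 : ℝ) ≤ q := by exact_mod_cast hq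
  have hUcard : (#U : ℝ) ≤ R := by
    have := card_le_card hU
    rw [Nat.card_Ioc] at this
    exact_mod_cast (by omega : #U ≤ R)
  set w : ℤ → ℂ := fun k => 𝓕 (jtMajorantC S) ((k : ℝ) / q) with hw
  have hw_min : ∀ k : ℤ, k ≠ 0 → ‖w k‖ ≤ Cg * (S * min 1 (((q : ℝ) / S / |(k : ℝ)|) ^ 2)) := fun k hk =>
    norm_fourier_jtMajorantC_div_le_min hCg hCg0.le hSr hqr (by exact_mod_cast hk)
  have hsumm : Summable fun k : ℤ => ‖w k‖ := summable_norm_fourier_jtMajorantC_div hSr hqr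
  -- truncation parameter
  set L : ℕ := ⌈2 * Cg⌉₊ * q ^ 2 * R + 1 with hL
  have hL1 : 1 ≤ L := by omega
  set T : ℝ := 2 * (Cg * (q : ℝ) ^ 2 / S) / L with hT
  have hT0 : 0 ≤ T := by positivity
  have hRT : (R : ℝ) * T ≤ 1 := by
    rw [hT]
    have hL' : (⌈2 * Cg⌉₊ : ℝ) * (q : ℝ) ^ 2 * R ≤ L := by
      rw [hL]; push_cast; linarith
    have hc : 2 * Cg ≤ (⌈2 * Cg⌉₊ : ℝ) := Nat.le_ceil _
    have hLpos : (0 : ℝ) < L := by exact_mod_cast (show 0 < L by omega)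
    rw [mul_div_assoc', div_le_one hLpos]
    calc (R : ℝ) * (2 * (Cg * (q : ℝ) ^ 2 / S)) = (2 * Cg) * (q : ℝ) ^ 2 * R / S := by ring
      _ ≤ (2 * Cg) * (q : ℝ) ^ 2 * R := div_le_self (by positivity) hS1
      _ ≤ (⌈2 * Cg⌉₊ : ℝ) * (q : ℝ) ^ 2 * R := by gcongr
      _ ≤ L := hL'
  set I : Finset ℤ := Icc (-(L : ℤ)) L with hI
  set K : Finset ℤ := I.filter (· ≠ 0) with hK
  -- Poisson + truncation for each class `c`
  set g : ℤ → ℤ → ℂ := fun c k => e ((c : ℝ) * k / q) * w k with hg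
  have hg_norm : ∀ c k, ‖g c k‖ = ‖w k‖ := fun c k => by
    rw [hg]; dsimp only; rw [norm_mul, LargeSieve.norm_e, one_mul]
  have hg_summ : ∀ c, Summable (g c) := fun c =>
    Summable.of_norm_bounded hsumm fun k => (hg_norm c k).le
  set τ : ℤ → ℂ := fun c => ∑' x : ((↑I : Set ℤ)ᶜ : Set ℤ), g c x with hτ
  have hτ_le : ∀ c, ‖τ c‖ ≤ T := by
    intro c
    have h1 : ‖τ c‖ ≤ ∑' x : ((↑I : Set ℤ)ᶜ : Set ℤ), ‖g c x‖ :=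
      norm_tsum_le_tsum_norm ((hg_summ c).norm.subtype _)
    refine h1.trans (Real.tsum_le_of_sum_le (fun _ => norm_nonneg _) fun F' => ?_)
    have h2 : ∑ x ∈ F', ‖g c x‖ = ∑ k ∈ F'.map (Function.Embedding.subtype _), ‖w k‖ := by
      rw [sum_map]; exact sum_congr rfl fun x _ => hg_norm c x
    rw [h2]
    refine sum_norm_fourier_tail_le hCg hCg0.le hSr hq0 hL1 _ fun k hk => ?_
    rw [mem_map] at hk
    obtain ⟨x, -, rfl⟩ := hk
    have hx : (x : ℤ) ∉ I := fun h => x.2 (Finset.mem_coe.mpr h)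
    simp only [hI, mem_Icc, not_and_or, not_le, Function.Embedding.subtype_apply] at hx ⊢
    rcases hx with h | h
    · rw [abs_of_neg (by omega)]; omega
    · rw [abs_of_pos (by omega)]; omega
  have hPoisson : ∀ c : ℤ,
      ∑ s ∈ (range (3 * S)).filter (fun s : ℕ => (q : ℤ) ∣ (s : ℤ) - c), (jtMajorant S s : ℂ) =
        (q : ℂ)⁻¹ * (w 0 + ∑ k ∈ K, g c k + τ c) := by
    intro c
    rw [← tsum_jtMajorantC_arithProg_eq_sum (by omega) hq0 c, tsum_jtMajorantC_arithProg hSr hq0 c]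
    congr 1
    have hsplit := (hg_summ c).sum_add_tsum_compl (s := I)
    rw [← hsplit]
    have h0 : (0 : ℤ) ∈ I := by simp [hI]
    rw [hK, Finset.filter_ne', ← Finset.add_sum_erase I _ h0]
    have : g c 0 = w 0 := by
      rw [hg]; dsimp only; rw [Int.cast_zero, mul_zero, zero_div, LargeSieve.e_zero, one_mul]
    rw [this]
  -- the decomposition `Y(a) = A + B(a) + E(a)`
  set G : ℕ → ℤ → ℂ := fun a k => ∑ r ∈ U, χ r * e (((((a * r : ℕ) : ℤ)) : ℝ) * (k : ℝ) / q) with hG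
  have hGeq : ∀ a k, G a k = ∑ r ∈ U, χ r * e ((a * r : ℕ) * (k : ℝ) / q) := by
    intro a k; simp only [hG, Int.cast_natCast]
  set A : ℂ := (q : ℂ)⁻¹ * w 0 * ∑ r ∈ U, χ r with hA
  set B : ℕ → ℂ := fun a => (q : ℂ)⁻¹ * ∑ k ∈ K, w k * G a k with hB
  set E : ℕ → ℂ := fun a => (q : ℂ)⁻¹ * ∑ r ∈ U, χ r * τ ((a * r : ℕ) : ℤ) with hE
  have hY : ∀ a : ℕ, ∑ r ∈ U, χ r *
      ∑ s ∈ (range (3 * S)).filter (fun s : ℕ => (q : ℤ) ∣ (s : ℤ) - ((a * r : ℕ) : ℤ)),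
        (jtMajorant S s : ℂ) = A + B a + E a := by
    intro a
    have step1 : ∀ r ∈ U, χ r *
        ∑ s ∈ (range (3 * S)).filter (fun s : ℕ => (q : ℤ) ∣ (s : ℤ) - ((a * r : ℕ) : ℤ)),
          (jtMajorant S s : ℂ) =
        (q : ℂ)⁻¹ * (χ r * w 0) + (q : ℂ)⁻¹ * (χ r * ∑ k ∈ K, g ((a * r : ℕ) : ℤ) k) +
          (q : ℂ)⁻¹ * (χ r * τ ((a * r : ℕ) : ℤ)) := by
      intro r _
      rw [hPoisson]; ring
    have step2 : ∑ r ∈ U, χ r * ∑ k ∈ K, g ((a * r : ℕ) : ℤ) k = ∑ k ∈ K, w k * G a k := by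
      calc ∑ r ∈ U, χ r * ∑ k ∈ K, g ((a * r : ℕ) : ℤ) k
          = ∑ r ∈ U, ∑ k ∈ K, χ r * g ((a * r : ℕ) : ℤ) k := by
            refine sum_congr rfl fun r _ => ?_; rw [mul_sum]
        _ = ∑ k ∈ K, ∑ r ∈ U, χ r * g ((a * r : ℕ) : ℤ) k := sum_comm
        _ = ∑ k ∈ K, w k * G a k := by
            refine sum_congr rfl fun k _ => ?_
            rw [hG]; dsimp only
            rw [mul_sum]
            refine sum_congr rfl fun r _ => ?_
            rw [hg]; dsimp only
            ring
    have hApart : ∑ r ∈ U, (q : ℂ)⁻¹ * (χ r * w 0) = A := by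
      rw [hA, mul_assoc, mul_sum, mul_sum]
      exact sum_congr rfl fun r _ => by ring
    have hBpart : ∑ r ∈ U, (q : ℂ)⁻¹ * (χ r * ∑ k ∈ K, g ((a * r : ℕ) : ℤ) k) = B a := by
      rw [hB]; dsimp only; rw [← mul_sum, step2]
    have hEpart : ∑ r ∈ U, (q : ℂ)⁻¹ * (χ r * τ ((a * r : ℕ) : ℤ)) = E a := by
      rw [hE]; dsimp only; rw [← mul_sum]
    rw [sum_congr rfl step1, sum_add_distrib, sum_add_distrib, hApart, hBpart, hEpart]
  -- the three bounds
  -- (i) the constant term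
  have hA_sum : ∑ a ∈ range q, ‖A‖ ^ 2 = 1 / q * ‖w 0‖ ^ 2 * ‖∑ r ∈ U, χ r‖ ^ 2 := by
    rw [sum_const, card_range, nsmul_eq_mul, hA, norm_mul, norm_mul, norm_inv, Complex.norm_natCast]
    field_simp
  -- (ii) the tail term
  have hE_le : ∀ a, ‖E a‖ ≤ 1 / q := by
    intro a
    rw [hE]; dsimp only
    rw [norm_mul, norm_inv, Complex.norm_natCast, ← div_eq_inv_mul, div_le_div_iff_of_pos_right hqr]
    calc ‖∑ r ∈ U, χ r * τ ((a * r : ℕ) : ℤ)‖ ≤ ∑ r ∈ U, ‖χ r * τ ((a * r : ℕ) : ℤ)‖ := norm_sum_le _ _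
      _ ≤ ∑ r ∈ U, T := sum_le_sum fun r _ => by
          rw [norm_mul]
          calc ‖χ r‖ * ‖τ _‖ ≤ 1 * T := mul_le_mul (hχ r) (hτ_le _) (norm_nonneg _) zero_le_one
            _ = T := one_mul T
      _ = #U * T := by rw [sum_const, nsmul_eq_mul]
      _ ≤ R * T := mul_le_mul_of_nonneg_right hUcard hT0
      _ ≤ 1 := hRT
  have hE_sum : ∑ a ∈ range q, ‖E a‖ ^ 2 ≤ 1 := by
    calc ∑ a ∈ range q, ‖E a‖ ^ 2 ≤ ∑ a ∈ range q, (1 / q : ℝ) ^ 2 :=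
          sum_le_sum fun a _ => pow_le_pow_left₀ (norm_nonneg _) (hE_le a) 2
      _ = q * (1 / q) ^ 2 := by rw [sum_const, card_range, nsmul_eq_mul]
      _ = 1 / q := by field_simp
      _ ≤ 1 := by rw [div_le_one hqr]; exact hq1
  -- (iii) the nonzero frequencies
  have hB_sum : ∑ a ∈ range q, ‖B a‖ ^ 2 ≤ 6 * Cg ^ 2 * Cl * R * ((R : ℝ) + S) * ((q : ℝ) * R) ^ ε := by
    -- remove the factor `q⁻¹`
    have h1 : ∑ a ∈ range q, ‖B a‖ ^ 2 = (1 / q) ^ 2 * ∑ a ∈ range q, ‖∑ k ∈ K, w k * G a k‖ ^ 2 := by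
      rw [mul_sum]
      refine sum_congr rfl fun a _ => ?_
      rw [hB]; dsimp only
      rw [norm_mul, norm_inv, Complex.norm_natCast, mul_pow, one_div]
    -- expand the square and use orthogonality
    have h2 : ∑ a ∈ range q, ‖∑ k ∈ K, w k * G a k‖ ^ 2 ≤
        ∑ k ∈ K, ∑ k' ∈ K, ‖w k‖ * ‖w k'‖ *
          (q * #((U ×ˢ U).filter fun p : ℕ × ℕ => (q : ℤ) ∣ (p.1 : ℤ) * k - k' * p.2)) := by
      have hc := sum_norm_sq_sum_eq (range q) K (fun a k => w k * G a k)
      have hreal : ∑ a ∈ range q, ‖∑ k ∈ K, w k * G a k‖ ^ 2 =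
          ‖((∑ a ∈ range q, ‖∑ k ∈ K, w k * G a k‖ ^ 2 : ℝ) : ℂ)‖ := by
        rw [Complex.norm_real, Real.norm_eq_abs, abs_of_nonneg (sum_nonneg fun _ _ => by positivity)]
      rw [hreal, hc]
      refine (norm_sum_le _ _).trans (sum_le_sum fun k _ => (norm_sum_le _ _).trans
        (sum_le_sum fun k' _ => ?_))
      have hfac : ∑ a ∈ range q, w k * G a k * conj (w k' * G a k') =
          w k * conj (w k') * ∑ a ∈ range q, G a k * conj (G a k') := by
        rw [mul_sum]
        refine sum_congr rfl fun a _ => ?_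
        rw [map_mul]; ring
      rw [hfac, norm_mul, norm_mul, Complex.norm_conj]
      refine mul_le_mul_of_nonneg_left ?_ (by positivity)
      simp only [hGeq]
      exact norm_sum_G_mul_conj_G_le hq0 U hχ k k'
    -- the count, summed with the weights
    have h3 : ∀ k ∈ K, ∑ k' ∈ K, ‖w k‖ * ‖w k'‖ *
        (q * #((U ×ˢ U).filter fun p : ℕ × ℕ => (q : ℤ) ∣ (p.1 : ℤ) * k - k' * p.2)) ≤
          ‖w k‖ * (q * (R * (Cg * (Cl * ((R : ℝ) + S) * ((q : ℝ) * R) ^ ε)))) := by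
      intro k _
      -- the count as a sum over `r`
      have hre : ∀ k' : ℤ, (#((U ×ˢ U).filter fun p : ℕ × ℕ => (q : ℤ) ∣ (p.1 : ℤ) * k - k' * p.2) : ℝ) =
          ∑ r ∈ U, (#(U.filter fun r' : ℕ => (q : ℤ) ∣ (r : ℤ) * k - k' * (r' : ℤ)) : ℝ) := by
        intro k'
        rw [card_filter_product_eq_sum]; push_cast; rfl
      -- the layered count for each `r`
      have hlay : ∀ r ∈ U, ∑ k' ∈ K, ‖w k'‖ *
          (#(U.filter fun r' : ℕ => (q : ℤ) ∣ (r : ℤ) * k - k' * (r' : ℤ)) : ℝ) ≤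
            Cg * (Cl * ((R : ℝ) + S) * ((q : ℝ) * R) ^ ε) := by
        intro r _
        have hl := hCl q R S L ((r : ℤ) * k) U (fun k' => ‖w k'‖ / Cg) hq0 hR hS hU
          (fun k' => by positivity) (fun k' hk' => by
            rw [div_le_iff₀' hCg0]; exact hw_min k' hk')
        have : ∑ k' ∈ K, ‖w k'‖ * (#(U.filter fun r' : ℕ => (q : ℤ) ∣ (r : ℤ) * k - k' * (r' : ℤ)) : ℝ) =
            Cg * ∑ k' ∈ K, ‖w k'‖ / Cg *
              (#(U.filter fun r' : ℕ => (q : ℤ) ∣ (r : ℤ) * k - k' * (r' : ℤ)) : ℝ) := by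
          rw [mul_sum]; refine sum_congr rfl fun k' _ => ?_; field_simp
        rw [this]
        exact mul_le_mul_of_nonneg_left hl hCg0.le
      calc ∑ k' ∈ K, ‖w k‖ * ‖w k'‖ *
            (q * #((U ×ˢ U).filter fun p : ℕ × ℕ => (q : ℤ) ∣ (p.1 : ℤ) * k - k' * p.2))
          = ‖w k‖ * (q * ∑ k' ∈ K, ‖w k'‖ *
              (#((U ×ˢ U).filter fun p : ℕ × ℕ => (q : ℤ) ∣ (p.1 : ℤ) * k - k' * p.2) : ℝ)) := by
            rw [mul_sum, mul_sum]
            exact sum_congr rfl fun k' _ => by ring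
        _ = ‖w k‖ * (q * ∑ r ∈ U, ∑ k' ∈ K, ‖w k'‖ *
              (#(U.filter fun r' : ℕ => (q : ℤ) ∣ (r : ℤ) * k - k' * (r' : ℤ)) : ℝ)) := by
            congr 2
            simp_rw [hre, mul_sum]
            exact sum_comm
        _ ≤ ‖w k‖ * (q * ∑ r ∈ U, Cg * (Cl * ((R : ℝ) + S) * ((q : ℝ) * R) ^ ε)) := by
            gcongr with r hr
            exact hlay r hr
        _ ≤ ‖w k‖ * (q * (R * (Cg * (Cl * ((R : ℝ) + S) * ((q : ℝ) * R) ^ ε)))) := by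
            rw [sum_const, nsmul_eq_mul]
            gcongr
    have h4 : ∑ k ∈ K, ‖w k‖ ≤ 6 * Cg * q := sum_norm_fourier_trunc_le hCg hCg0.le hSr hq0 L
    calc ∑ a ∈ range q, ‖B a‖ ^ 2
        = (1 / q) ^ 2 * ∑ a ∈ range q, ‖∑ k ∈ K, w k * G a k‖ ^ 2 := h1
      _ ≤ (1 / q) ^ 2 * ∑ k ∈ K, ‖w k‖ * (q * (R * (Cg * (Cl * ((R : ℝ) + S) * ((q : ℝ) * R) ^ ε)))) := by
          refine mul_le_mul_of_nonneg_left (h2.trans (sum_le_sum h3)) (by positivity)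
      _ = (1 / q) ^ 2 * ((∑ k ∈ K, ‖w k‖) * (q * (R * (Cg * (Cl * ((R : ℝ) + S) * ((q : ℝ) * R) ^ ε))))) := by
          rw [sum_mul]
      _ ≤ (1 / q) ^ 2 * ((6 * Cg * q) * (q * (R * (Cg * (Cl * ((R : ℝ) + S) * ((q : ℝ) * R) ^ ε))))) := by
          refine mul_le_mul_of_nonneg_left (mul_le_mul_of_nonneg_right h4 (by positivity)) (by positivity)
      _ = 6 * Cg ^ 2 * Cl * R * ((R : ℝ) + S) * ((q : ℝ) * R) ^ ε := by
          field_simp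
  -- combine
  have hqRS : ((q : ℝ) * R) ^ ε ≤ ((q : ℝ) * R * S) ^ ε :=
    Real.rpow_le_rpow (by positivity) (le_mul_of_one_le_right (by positivity) hS1) hε.le
  have hbig : (1 : ℝ) ≤ R * ((R : ℝ) + S) * ((q : ℝ) * R * S) ^ ε := by
    have h1 : (1 : ℝ) ≤ ((q : ℝ) * R * S) ^ ε := Real.one_le_rpow (by nlinarith [mul_pos hqr (by linarith : (0:ℝ) < R)]) hε.le
    nlinarith [mul_nonneg (by linarith : (0:ℝ) ≤ R) (by linarith : (0 : ℝ) ≤ R + S)]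
  calc ∑ a ∈ range q, ‖∑ r ∈ U, χ r *
          ∑ s ∈ (range (3 * S)).filter (fun s : ℕ => (q : ℤ) ∣ (s : ℤ) - ((a * r : ℕ) : ℤ)),
            (jtMajorant S s : ℂ)‖ ^ 2
      = ∑ a ∈ range q, ‖A + B a + E a‖ ^ 2 := sum_congr rfl fun a _ => by rw [hY a]
    _ ≤ ∑ a ∈ range q, 3 * (‖A‖ ^ 2 + ‖B a‖ ^ 2 + ‖E a‖ ^ 2) :=
        sum_le_sum fun a _ => norm_add_three_sq_le _ _ _
    _ = 3 * (∑ a ∈ range q, ‖A‖ ^ 2 + ∑ a ∈ range q, ‖B a‖ ^ 2 + ∑ a ∈ range q, ‖E a‖ ^ 2) := by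
        rw [← sum_add_distrib, ← sum_add_distrib, mul_sum]
    _ ≤ 3 * (1 / q * ‖w 0‖ ^ 2 * ‖∑ r ∈ U, χ r‖ ^ 2 +
          6 * Cg ^ 2 * Cl * R * ((R : ℝ) + S) * ((q : ℝ) * R) ^ ε + 1) := by
        rw [hA_sum]; gcongr
    _ ≤ 3 / q * ‖w 0‖ ^ 2 * ‖∑ r ∈ U, χ r‖ ^ 2 +
          (18 * Cg ^ 2 * Cl + 3) * R * ((R : ℝ) + S) * ((q : ℝ) * R * S) ^ ε := by
        have h0 : 0 ≤ 6 * Cg ^ 2 * Cl * R * ((R : ℝ) + S) := by positivity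
        have h1 := mul_le_mul_of_nonneg_left hqRS h0
        have h2 : 3 / q * ‖w 0‖ ^ 2 * ‖∑ r ∈ U, χ r‖ ^ 2 =
            3 * (1 / q * ‖w 0‖ ^ 2 * ‖∑ r ∈ U, χ r‖ ^ 2) := by ring
        rw [h2]
        nlinarith
    _ = 3 / q * ‖𝓕 (jtMajorantC S) 0‖ ^ 2 * ‖∑ r ∈ U, χ r‖ ^ 2 +
          (18 * Cg ^ 2 * Cl + 3) * R * ((R : ℝ) + S) * ((q : ℝ) * R * S) ^ ε := by
        have hw0 : w 0 = 𝓕 (jtMajorantC S) 0 := by rw [hw]; simp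
        rw [hw0]


end Literature.NumberTheory.Sieve.FriedlanderIwaniecPrimes
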